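import Summits.QuantumFields.BalabanUV.T4Continuum.Spine.NE1p.DressedSmallFieldComponentInnerMuNestedTori
import Summits.QuantumFields.BalabanUV.T4Continuum.Support.SubstrateBondsOfCubes

/-!
# T⁴ programme, spine estimate NE1′ (node O3b/H2) — THE (B3-count) CHAIN's NESTED-TORI ENDs AT THE CARRIERS OF RECORD WITH PRINT's BONDS:
# S51's single-component END (table pencil) and S57's μ-twin (road P1's source pencil) fired ONCE each at `C := R.carriers`, `L := R.F.L`
# (`3 ≤ L` from the family's `11 < L`), `N′ := R.cubesPerDir (k+1)`, `emb := domEmb R (k+1)` (`hscale` by `rfl`), `Bnd := Bnd R` and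
# `bondsOf := bondsOfFineCubes hk` — N0u's bonds-per-cube letter `hb₀` DISCHARGED by the substrate's W-23c `card_bondsOfFineCubes_le_real`
# with `b₀ = 4·L^{4m′}` LOCATED; [Balaban1988RGII] pp. 12, 17–20 KIND, μ-extension UNPRINTED

Cell `pub-balaban`, sub-cell `t4`, BINDER-OWNERS row NE1′ (owner lineage t4-ne1p-p1, road P1 «RG-trajectory comparison … μ-uniformity
through the printed small-field bounds»); crew seat `b2b-balaban-t4-ne1p-formalise-leaf-01` (LEAF PROVER 01, generation 15); crew S-row
S⟨next⟩ ∕ DAG N29⟨next⟩ «S51 ∕ S57 AT THE CARRIERS OF RECORD WITH PRINT's BONDS» (own-initiative, announced in this seat's W-LANDED line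
`CLAIMS.log` 2026-08-20 l.23514; INTENT + PROTOTYPE + STAGED in the journal; the typer gen 8 labels it, R-T141) — the crew analogue, for the
COMPOSED (B3-count) chain, of the owner's N1a PART 3 `DressedSmallFieldRecordLabelsCarriersBonds` (p240812) for N0y.  ADDITIVE — imports
this lineage's S57 `Spine/NE1p/DressedSmallFieldComponentInnerMuNestedTori` (p240443 ✓✓; → S51 p238434 ✓✓, N0z, N0x P2, S41.2, S44,
S40.1, pv22) and the substrate's W-23c `Support/SubstrateBondsOfCubes` (substrate-p1 g6, p239727 ✓; → W-23 `SubstrateNestedToriOfRecord` →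
`B13Carriers` ∕ `B13DomainGeometryTR` ∕ `B13InnerData`) ONLY; THEOREMS ONLY (0 `def`, 0 `def … : Prop`, 0 cite); nothing of S51 ∕ S57 ∕
W-23c ∕ N1a is restated — `attachedPart_locE_le_of_coresAt_pencil_components_inner_nestedTori` (S51),
`muPart_locE_le_of_coresAt_pencil_components_inner_nestedTori` (S57), `bondsOfFineCubes` ∕ `card_bondsOfFineCubes_le_real` (W-23c),
`domEmb` (`B13DomainGeometryTR`) are used BY NAME, ONCE per END.

WHY THIS FILE.  S51 ∕ S57 put the whole (B3-count) chain and its μ-twin on pv22's nested tori `(tsys 4 N′, tsys 4 (L·N′))` with every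
GEOMETRIC binder supplied, for generic `L`, `N′`, generic carriers `C` with an embedding `emb`∕`hscale`, a generic bond type `Bnd` and
N0u's bonds-per-cube letter `bondsOf`∕`hb₀` DISPLAYED ([Balaban1988RGII] p. 12 «P ⊂ Y₀^{c*}», p. 18 «one bond in P may connect two
cubes in Z₀∖Y₀» — KIND).  On the CARRIERS OF RECORD (`R : TwoRuns G`, W-23: the scale-`(k+1)` torus has `R.cubesPerDir (k+1)` cubes per
direction, the fine one `R.F.L` times as many; the catalogue embedding `domEmb R (k+1) Z = ⟨k+1, Z⟩`, scale by `rfl`) the bonds ARE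
Bałaban's lattice bonds: W-23c's `bondsOfFineCubes hk W` = the level-`k` bonds with both endpoint cubes in the fine cube family `W`,
counted `#(bondsOfFineCubes hk W) ≤ (4·L^{4m′})·#W` (`card_bondsOfFineCubes_le_real`, `hk : k + 1 + m′ ≤ m + K` the standing range).  The
owner did this for N0y (N1a PART 3); this file does it for the composed chain:
* §1 **`attachedPart_locE_le_of_coresAt_pencil_components_inner_carriersBonds`** — S51's single-component END ONCE at the carriers with
  print's bonds: `bondsOf`∕`hb₀`∕`b₀`, `emb`∕`hscale`, `hL` GONE (`b₀ := 4·L^{4m′}` appears LOCATED inside `u_k = e^{5R_k}·s·e^{b₀t}`);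
* §2 **`muPart_locE_le_of_coresAt_pencil_components_inner_carriersBonds`** — S57 §2 (the μ-twin) ONCE with the same supplies.
WHAT STAYS DISPLAYED (binders, by name; NOTHING instantiated on Bałaban's densities): the cores `𝔊` (the cell's typed (2.14)-FORMAT at the
carriers' domains), the room, operator conditions, class radii; (B1b)'s residue `terms`∕`hact` and `hadm` — now with PRINT's bonds in
N0u's admissibility clause `P ⊆ bondsOfFineCubes hk W`, `#W ≤ 2·#P` ((B1b)∕(2.35) READING: which labels the terms carry); N0u's table
letters `δ κ α₆ R_k s t`; the uncovered-cube weight `v`∕`vW`; (B3-amp) `hAmp` (p. 18's clause KIND at `C₃(E₀+D₀)`, NOT asserted); the located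
clauses and rate bookkeeping with `u_k := e^{5R_k}·s·e^{4L^{4m′}·t}`; N0m's `hϱ`∕`hϱA` (§1), road P1's `h0`∕`h01`∕`hμ` (§2); `hk`.
WHAT IT SAYS FOR THE WALL (the owner's reading, wall v1.8 of record, T4-DAG v48 §6 NE1 — v49∕v50 carry it verbatim; nothing re-labelled
here): (B1b)'s residue for the composed (B3-count) chain at the carriers of record is `terms`∕`hact`∕`hadm` with print's bonds — `emb`∕
`hscale` rfl-level, `bondsOf`∕`hb₀` KERNEL (lattice combinatorics, W-23c); the identification of `tsys`∕`torusTreeLen`∕`tclosureDom`∕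
`domEmb`∕`bondsOfFineCubes` with Bałaban's 𝐃_k ⊂ 𝐃_{k+1} ∕ d_k ∕ Z′ ∕ bonds of P is pv22's ∕ the substrate's READING (D-pv22.3), asserted
nowhere; (B3-amp) `hAmp` and (B5)-KIND arithmetic unchanged.  NOTHING of (B3) discharged on Bałaban's (2.14) densities; 0 binders
instantiated on Bałaban's densities; no wall item moves; wall v1.8 (T4-DAG v48) — words, not kind — does NOT move; R-t4r2-Q2 NOT met
thereby; NE1′ ⇐ the named binders — ONE label NEW ∕ NOT PRINTED ∕ NOT PROVED; spine PROVED 0∕9; count 9 unchanged.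

PRINTED LOCI (TYPE ∕ CONTEXT only — [Balaban1988RGII] = T. Bałaban, Renormalization group approach to lattice gauge field theories. II,
Commun. Math. Phys. 116 (1988) 1–22, quoted VERBATIM in the imported S51 ∕ N1a ∕ W-23c headers from the renders
`b2b-balaban-ref1/pages/1988-cmp116-rg-II-cluster/…`; no new render reading is claimed here): p. 12 «the smallest localization domain Z₀ ∈
𝐃_k containing Y₀ and P … bonds of P»; p. 18 (2.27), (2.29), «|P| ≥ ½M⁻⁴|Z₀∖Y₀|»; p. 19 (2.35)∕(2.36); p. 20 (2.37), C₃, Lemma 3 (2.38).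
The μ-extension is the cell's, UNPRINTED ([Balaban1989LargeFieldII] p. 356 defers observables).  Bałaban's «L a fixed large odd integer»
([Balaban1987RGI] p. 251) is the family's field `R.F.hL`∕`R.F.hL11`, a binder of the carriers — no numeral of print is asserted.
HONEST FRAMING.  By-name composition of LANDED kernel theorems over binder SHAPES on the CONSTRUCTED carriers ∕ tori of record; cores ∕
labels are the cell's typed FORMAT of (2.14) and of the resummation index, NOT Bałaban's functions; `bondsOfFineCubes` is lattice
combinatorics on run A's lattice, NOT a statement about which bonds Bałaban's expansion produces (that is `hadm`, READING); ABSOLUTE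
RULE honoured — nothing internally minted is cited, [folklore] tags on kernel theorems only.  Rung (B)+1 on ONE finite four-torus of
fixed physical size — NOT infinite volume, NOT a mass gap, NOT OS on ℝ⁴, NOT Clay.  HONEST DEPENDENCY: continuum YM on T⁴ ⇐ BetaPertH ∧
nine spine estimates (0/9 proved); BetaPertH ⇐ (D1) ∧ (D4) ∧ CAP+tail; G-an2-4 gates asym, D1 and NE2/3/4.
-/

noncomputable section

namespace Summit.QuantumFields.BalabanUV.T4Continuum.NE1p.DressedSmallFieldComponentInnerCarriersBonds

open Metric Set Complex MeasureTheory
open scoped BigOperators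
open Literature.MathematicalPhysics.QuantumFieldTheory.Balaban1983to89 (GaugeGroup)
open Literature.MathematicalPhysics.QuantumFieldTheory.Balaban1983to89.B13FamilySum (coveringFamilies)
open Literature.MathematicalPhysics.QuantumFieldTheory.Balaban1983to89.T4OutputRate (Carriers)
open Literature.MathematicalPhysics.QuantumFieldTheory.Balaban1983to89.B13Resummation (locE)
open Literature.MathematicalPhysics.QuantumFieldTheory.Balaban1983to89.TreeLengthTorus (TPt TDom tsys torusTreeLen)
open Literature.MathematicalPhysics.QuantumFieldTheory.Balaban1983to89.TreeLengthTorusGeometry (TTouch tgeometry)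
open Literature.MathematicalPhysics.QuantumFieldTheory.Balaban1983to89.TreeLengthTorusTransfer (tclosureDom)
open Literature.MathematicalPhysics.QuantumFieldTheory.Balaban1983to89.B12TreeDecay (K₀)
open Literature.MathematicalPhysics.QuantumFieldTheory.Balaban1983to89.B13Geometry236 (a236)
open Summit.QuantumFields.BalabanUV.T4Continuum.B13HistMeasurable (MeasPotFrame B13HistM)
open Summit.QuantumFields.BalabanUV.T4Continuum.B13TermParamGaussianBi (BiCore)
open Summit.QuantumFields.BalabanUV.T4Continuum.B13Carriers (TwoRuns)
open Summit.QuantumFields.BalabanUV.T4Continuum.B13InnerData (Bnd)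
open Summit.QuantumFields.BalabanUV.T4Continuum.B13DomainGeometryTR (domEmb)
open Summit.QuantumFields.BalabanUV.T4Continuum.SubstrateBondsOfCubes (bondsOfFineCubes card_bondsOfFineCubes_le_real)
open Summit.QuantumFields.BalabanUV.T4Continuum.NE1p.DressedSmallFieldComponentInnerNestedTori
  (attachedPart_locE_le_of_coresAt_pencil_components_inner_nestedTori)
open Summit.QuantumFields.BalabanUV.T4Continuum.NE1p.DressedSmallFieldComponentInnerMuNestedTori
  (muPart_locE_le_of_coresAt_pencil_components_inner_nestedTori)

-- F-ne1pp1-g31-1: the carriers' cone brings the structural `DecidableEq (TDom d N)`; S51 ∕ S57's statements were elaborated without it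
-- (`TDom` is a plain `def`, their `open Classical in` supplied `DecidableEq`), so it is switched off here to keep the ENDs' instance terms
-- syntactically those of S51 ∕ S57 (else `isDefEq` unfolds `ZMod (R.F.L * R.cubesPerDir (k+1))`'s decidability by cases and times out).
attribute [-instance] Summit.QuantumFields.BalabanUV.T4Continuum.B13Carriers.TwoRuns.instDecidableEqTDom

variable {G : Type} [GaugeGroup G] (R : TwoRuns G) {k : ℕ} (hk : k + 1 + R.m' ≤ R.F.m + R.K)
variable {P : MeasPotFrame R.carriers} {Op : Type*} [NormedAddCommGroup Op] [NormedSpace ℂ Op]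

variable
  {𝒴 : ℕ → (Σ _ : Finset (TPt 4 (R.cubesPerDir (k + 1))), Σ F : Finset (tsys 4 (R.cubesPerDir (k + 1))).Dom, ∀ Z ∈ F,
    (Σ _ : (tsys 4 (R.F.L * R.cubesPerDir (k + 1))).Dom, (Σ _ : Finset (TPt 4 (R.F.L * R.cubesPerDir (k + 1))), Finset (tsys 4 (R.F.L * R.cubesPerDir (k + 1))).Dom × Finset (Bnd R)))) → Type*}
  {dom : ∀ k i, 𝒴 k i → R.carriers.Dom}
  {β : ℕ → (Σ _ : Finset (TPt 4 (R.cubesPerDir (k + 1))), Σ F : Finset (tsys 4 (R.cubesPerDir (k + 1))).Dom, ∀ Z ∈ F,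
    (Σ _ : (tsys 4 (R.F.L * R.cubesPerDir (k + 1))).Dom, (Σ _ : Finset (TPt 4 (R.F.L * R.cubesPerDir (k + 1))), Finset (tsys 4 (R.F.L * R.cubesPerDir (k + 1))).Dom × Finset (Bnd R)))) → Type*}
  [∀ k i, MeasurableSpace (β k i)]
  {α : ℕ → (Σ _ : Finset (TPt 4 (R.cubesPerDir (k + 1))), Σ F : Finset (tsys 4 (R.cubesPerDir (k + 1))).Dom, ∀ Z ∈ F,
    (Σ _ : (tsys 4 (R.F.L * R.cubesPerDir (k + 1))).Dom, (Σ _ : Finset (TPt 4 (R.F.L * R.cubesPerDir (k + 1))), Finset (tsys 4 (R.F.L * R.cubesPerDir (k + 1))).Dom × Finset (Bnd R)))) → Type*}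
  [∀ k i, NormedAddCommGroup (α k i)] [∀ k i, InnerProductSpace ℝ (α k i)] [∀ k i, FiniteDimensional ℝ (α k i)]
  [∀ k i, MeasurableSpace (α k i)] [∀ k i, BorelSpace (α k i)]

/-! ## §1 S51's SINGLE-COMPONENT END AT THE CARRIERS OF RECORD WITH PRINT's BONDS (table pencil) -/

open Classical in
/-- **THE WHOLE (B3-count) CHAIN ON THE NESTED TORI OF RECORD, PRINT's BONDS COUNTED** (kernel; S51's
`attachedPart_locE_le_of_coresAt_pencil_components_inner_nestedTori` ONCE BY NAME at `L := R.F.L` (`hL : 3 ≤ L` from `R.F.hL11`),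
`N′ := R.cubesPerDir (k+1)`, `C := R.carriers`, output scale `k+1`, `emb := domEmb R (k+1)` (`hscale` by `rfl`), `Bnd := Bnd R`,
`bondsOf := bondsOfFineCubes hk`, `hb₀ := card_bondsOfFineCubes_le_real hk` — so N0u's uncovered-cube letter reads
`u_k = e^{5R_k}·s·e^{(4·L^{4m′})·t}` with `b₀ = 4·L^{4m′}` LOCATED).  DISPLAYED: everything else of S51's END VERBATIM at these instances
(cores `𝔊`, room, operator conditions, class radii, `terms`∕`hact`, `hadm` with `P ⊆ bondsOfFineCubes hk W`, table letters, `v`, (B3-amp)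
`hAmp`, located clauses, `hϱ`∕`hϱA`).  Binders = S51's MINUS [`hL`, `emb`, `hscale`, `bondsOf`, `b₀`, `hb₀`] PLUS [`R`, `hk`] (section).
Conclusion = the crew coarse-torus currency `4·(e·9·64·K₀(64,8)²)·A₁·e^{−r₁·d(X₀)}`. [folklore] -/
theorem attachedPart_locE_le_of_coresAt_pencil_components_inner_carriersBonds {Win : Set (ℕ → ℝ)}
    {ctr : ℕ → (ℕ → ℝ) → R.carriers.BgB → Op × B13HistM P} {ROp RHist R' : ℕ → ℝ}
    (𝔊 : ∀ k i, R.carriers.Dom → BiCore P (dom k i) Op (β k i) (α k i))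
    {mq bq N₀ : ℕ → (Σ _ : Finset (TPt 4 (R.cubesPerDir (k + 1))), Σ F : Finset (tsys 4 (R.cubesPerDir (k + 1))).Dom, ∀ Z ∈ F,
      (Σ _ : (tsys 4 (R.F.L * R.cubesPerDir (k + 1))).Dom, (Σ _ : Finset (TPt 4 (R.F.L * R.cubesPerDir (k + 1))), Finset (tsys 4 (R.F.L * R.cubesPerDir (k + 1))).Dom × Finset (Bnd R)))) →
      R.carriers.Dom → ℝ}
    (hroom : ∀ k, ROp k < R' k)
    (hm : ∀ k, ∀ g ∈ Win, ∀ (U : R.carriers.BgB) (X : R.carriers.Dom), R.carriers.scale X = k → ∀ i, 0 < mq k i X)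
    (hN : ∀ k, ∀ g ∈ Win, ∀ (U : R.carriers.BgB) (X : R.carriers.Dom), R.carriers.scale X = k → ∀ i,
      (∀ o ∈ ball (ctr k g U).1 (R' k), AEStronglyMeasurable ((𝔊 k i X).N o) (𝔊 k i X).lam) ∧
      (∀ p, DifferentiableOn ℂ (fun o => (𝔊 k i X).N o p) (ball (ctr k g U).1 (R' k))) ∧
      (∀ o ∈ ball (ctr k g U).1 (R' k), ∀ p, ‖(𝔊 k i X).N o p‖ ≤ N₀ k i X))
    (hq : ∀ k, ∀ g ∈ Win, ∀ (U : R.carriers.BgB) (X : R.carriers.Dom), R.carriers.scale X = k → ∀ i,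
      (∀ o ∈ ball (ctr k g U).1 (R' k),
        AEStronglyMeasurable (Function.uncurry ((𝔊 k i X).q o)) ((𝔊 k i X).lam.prod volume)) ∧
      (∀ p v, DifferentiableOn ℂ (fun o => (𝔊 k i X).q o p v) (ball (ctr k g U).1 (R' k))) ∧
      (∀ o ∈ ball (ctr k g U).1 (R' k), ∀ p v, mq k i X * ‖v‖ ^ 2 - bq k i X ≤ ((𝔊 k i X).q o p v).re))
    {g : ℕ → ℝ} (hg : g ∈ Win) {U : R.carriers.BgB} {o : Op} {h₀ w : B13HistM P} {ϱ : ℝ}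
    (hO : ‖o - (ctr (k + 1) g U).1‖ ≤ ROp (k + 1)) (hH : ‖h₀ - (ctr (k + 1) g U).2‖ + ϱ * ‖w‖ ≤ RHist (k + 1))
    {terms : (tsys 4 (R.cubesPerDir (k + 1))).Dom → Finset (Σ _ : Finset (TPt 4 (R.cubesPerDir (k + 1))), Σ F : Finset (tsys 4 (R.cubesPerDir (k + 1))).Dom, ∀ Z ∈ F,
      (Σ _ : (tsys 4 (R.F.L * R.cubesPerDir (k + 1))).Dom, (Σ _ : Finset (TPt 4 (R.F.L * R.cubesPerDir (k + 1))), Finset (tsys 4 (R.F.L * R.cubesPerDir (k + 1))).Dom × Finset (Bnd R))))}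
    {act : ℂ → (tsys 4 (R.cubesPerDir (k + 1))).Dom → ℂ}
    (hact : ∀ σ ∈ ball (0 : ℂ) ϱ, ∀ Z, act σ Z = ∑ i ∈ terms Z, (𝔊 (k + 1) i (domEmb R (k + 1) Z)).termAt o (h₀ + σ • w))
    {A₀ A₁ Rkp r₁ : ℝ} (X₀ : (tsys 4 (R.cubesPerDir (k + 1))).Dom) (hA₀ : 0 ≤ A₀) (hA₁ : 0 ≤ A₁) (hr₁ : 0 ≤ r₁)
    (hrate : r₁ + 2 * (64 * Real.log 162) + 2 ≤ Rkp)
    (hsmall : (A₀ + ϱ * A₁) * Real.exp (5 * r₁ + 1) * K₀ 64 8 * 9 * 64 ≤ 1)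
    -- scale `k` (the fine torus): N0u's table letters and bonds-per-cube letter; the link is GONE (`c₃₂ = 5`, `link_torus`)
    {δ κ α₆ Rk s t : ℝ}
    (hα₆ : 0 ≤ α₆) (hκk : 64 * Real.log 162 + 1 ≤ δ * κ) (h229k : Real.exp 1 * K₀ 64 8 * 64 * α₆ ≤ 1)
    (hs0 : 0 ≤ s) (hs1 : s ≤ 1) (ht : 0 ≤ t)
    -- scale `k+1` (the coarse torus): N0v's letters; closure ∕ anchor ∕ transfer ∕ link are GONE
    {ε r Rout v : ℝ} (hε : 0 ≤ ε) (hv : 0 ≤ v)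
    (hκR : 64 * Real.log 162 ≤ Rk - 64 * (Real.exp (Rk * 5) * s * Real.exp (4 * (R.F.L : ℝ) ^ (4 * R.m') * t)))
    (hrate2 : r + Rout ≤ (Rk - 64 * (Real.exp (Rk * 5) * s * Real.exp (4 * (R.F.L : ℝ) ^ (4 * R.m') * t)) - 64 * Real.log 162) * ((R.F.L : ℝ) / a236 R.F.L))
    (hκ : 64 * Real.log 162 + 1 ≤ r)
    (h229 : Real.exp 1 * K₀ 64 8 * 64 *
      (ε * Real.exp (64 * (Real.exp (Rk * 5) * s * Real.exp (4 * (R.F.L : ℝ) ^ (4 * R.m') * t)) - 5 * Rk) * ((3 : ℝ) ^ 4 * (R.F.L : ℝ) ^ 4) * K₀ 64 8 *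
        Real.exp (5 * Rout)) ≤ 1)
    (hRR : Rkp ≤ Rout - 64 * (v * Real.exp (Rout * 5)))
    (hadm : ∀ Z : (tsys 4 (R.cubesPerDir (k + 1))).Dom, ∀ l ∈ terms Z, l.1 ⊆ Z.1 ∧
      l.2.1 ∈ coveringFamilies Finset.univ (fun Y : (tsys 4 (R.cubesPerDir (k + 1))).Dom => Y.1) (Z.1 \ l.1) ∧
      ∀ Z' (h : Z' ∈ l.2.1), l.2.2 Z' h ∈
        ((Finset.univ : Finset (tsys 4 (R.F.L * R.cubesPerDir (k + 1))).Dom).filter (fun Z₀ => tclosureDom R.F.L (R.cubesPerDir (k + 1)) Z₀ = Z')).sigma fun Z₀ =>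
          Z₀.1.powerset.sigma fun W =>
            coveringFamilies Finset.univ (fun Y : (tsys 4 (R.F.L * R.cubesPerDir (k + 1))).Dom => Y.1) (Z₀.1 \ W) ×ˢ
              (bondsOfFineCubes hk W).powerset.filter fun P => W.card ≤ 2 * P.card)
    (hAmp : ∀ Z : (tsys 4 (R.cubesPerDir (k + 1))).Dom, Z.1 ⊆ X₀.1 → ∀ l ∈ terms Z,
      (𝔊 (k + 1) l (domEmb R (k + 1) Z)).lam.real univ * ((𝔊 (k + 1) l (domEmb R (k + 1) Z)).wB * N₀ (k + 1) l (domEmb R (k + 1) Z) * Real.exp (bq (k + 1) l (domEmb R (k + 1) Z))) *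
          (Real.pi / (mq (k + 1) l (domEmb R (k + 1) Z) / 2)) ^ (Module.finrank ℝ (α (k + 1) l) / 2 : ℝ) *
        Real.exp ((𝔊 (k + 1) l (domEmb R (k + 1) Z)).N₁ * (‖h₀‖ + ϱ * ‖w‖)) ≤
      (A₀ + ϱ * A₁) * (v ^ l.1.card * ∏ x ∈ l.2.1.attach, (ε *
        ((∏ Y ∈ (l.2.2 x.1 x.2).2.2.1,
            (α₆ * Real.exp (-(δ * κ * torusTreeLen Y.1)) * Real.exp (-(Rk * (torusTreeLen Y.1 + 5))))) *
          (s ^ 2 * t) ^ (l.2.2 x.1 x.2).2.2.2.card))))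
    (hϱ : 2 ≤ ϱ) (hϱA : A₀ ≤ ϱ * A₁) :
    ‖locE (TTouch (d := 4) (N := R.cubesPerDir (k + 1))) (fun Z : (tsys 4 (R.cubesPerDir (k + 1))).Dom => Z.1) (act 1) X₀.1 -
        locE (TTouch (d := 4) (N := R.cubesPerDir (k + 1))) (fun Z : (tsys 4 (R.cubesPerDir (k + 1))).Dom => Z.1) (act 0) X₀.1‖ ≤
      4 * (Real.exp 1 * 9 * 64 * K₀ 64 8 ^ 2) * A₁ * Real.exp (-(r₁ * torusTreeLen X₀.1)) :=
  attachedPart_locE_le_of_coresAt_pencil_components_inner_nestedTori (L := R.F.L) (N' := R.cubesPerDir (k + 1))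
    (by have := R.F.hL11; omega) 𝔊 hroom hm hN hq hg hO hH (emb := fun Z => domEmb R (k + 1) Z) (fun _ => rfl) hact X₀ hA₀ hA₁
    hr₁ hrate hsmall (bondsOfFineCubes hk) hα₆ hκk h229k hs0 hs1 ht (fun W => card_bondsOfFineCubes_le_real hk W) hε hv hκR hrate2 hκ
    h229 hRR hadm hAmp hϱ hϱA

/-! ## §2 S57's μ-TWIN AT THE CARRIERS OF RECORD WITH PRINT's BONDS (road P1's source pencil) -/

open Classical in
/-- **THE μ-TWIN, PRINT's BONDS COUNTED** (kernel; S57 §2 `muPart_locE_le_of_coresAt_pencil_components_inner_nestedTori` ONCE BY NAME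
with the SAME supplies as §1: `L := R.F.L`, `N′ := R.cubesPerDir (k+1)`, `C := R.carriers`, scale `k+1`, `emb := domEmb R (k+1)`,
`Bnd := Bnd R`, `bondsOf := bondsOfFineCubes hk`, `hb₀ := card_bondsOfFineCubes_le_real hk`).  The source window (`μ₁`, `μ₀`, `sμ`) and
the direction `v` occur ONLY in `hH`, `hact`, `hAmp` and the conclusion.  Binders = S57 §2's MINUS [`hL`, `emb`, `hscale`, `bondsOf`, `b₀`,
`hb₀`] PLUS [`R`, `hk`].  Conclusion = the torus μ-currency `e·9·64·K₀(64,8)²·A·e^{−r₁·d(X₀)}·μ₀∕(μ₁ − μ₀)`. [folklore] -/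
theorem muPart_locE_le_of_coresAt_pencil_components_inner_carriersBonds {Win : Set (ℕ → ℝ)}
    {ctr : ℕ → (ℕ → ℝ) → R.carriers.BgB → Op × B13HistM P} {ROp RHist R' : ℕ → ℝ}
    (𝔊 : ∀ k i, R.carriers.Dom → BiCore P (dom k i) Op (β k i) (α k i))
    {mq bq N₀ : ℕ → (Σ _ : Finset (TPt 4 (R.cubesPerDir (k + 1))), Σ F : Finset (tsys 4 (R.cubesPerDir (k + 1))).Dom, ∀ Z ∈ F,
      (Σ _ : (tsys 4 (R.F.L * R.cubesPerDir (k + 1))).Dom, (Σ _ : Finset (TPt 4 (R.F.L * R.cubesPerDir (k + 1))), Finset (tsys 4 (R.F.L * R.cubesPerDir (k + 1))).Dom × Finset (Bnd R)))) →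
      R.carriers.Dom → ℝ}
    (hroom : ∀ k, ROp k < R' k)
    (hm : ∀ k, ∀ g ∈ Win, ∀ (U : R.carriers.BgB) (X : R.carriers.Dom), R.carriers.scale X = k → ∀ i, 0 < mq k i X)
    (hN : ∀ k, ∀ g ∈ Win, ∀ (U : R.carriers.BgB) (X : R.carriers.Dom), R.carriers.scale X = k → ∀ i,
      (∀ o ∈ ball (ctr k g U).1 (R' k), AEStronglyMeasurable ((𝔊 k i X).N o) (𝔊 k i X).lam) ∧
      (∀ p, DifferentiableOn ℂ (fun o => (𝔊 k i X).N o p) (ball (ctr k g U).1 (R' k))) ∧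
      (∀ o ∈ ball (ctr k g U).1 (R' k), ∀ p, ‖(𝔊 k i X).N o p‖ ≤ N₀ k i X))
    (hq : ∀ k, ∀ g ∈ Win, ∀ (U : R.carriers.BgB) (X : R.carriers.Dom), R.carriers.scale X = k → ∀ i,
      (∀ o ∈ ball (ctr k g U).1 (R' k),
        AEStronglyMeasurable (Function.uncurry ((𝔊 k i X).q o)) ((𝔊 k i X).lam.prod volume)) ∧
      (∀ p v, DifferentiableOn ℂ (fun o => (𝔊 k i X).q o p v) (ball (ctr k g U).1 (R' k))) ∧
      (∀ o ∈ ball (ctr k g U).1 (R' k), ∀ p v, mq k i X * ‖v‖ ^ 2 - bq k i X ≤ ((𝔊 k i X).q o p v).re))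
    {g : ℕ → ℝ} (hg : g ∈ Win) {U : R.carriers.BgB} {o : Op} {h₀ v : B13HistM P} {μ₁ : ℝ}
    (hO : ‖o - (ctr (k + 1) g U).1‖ ≤ ROp (k + 1)) (hH : ‖h₀ - (ctr (k + 1) g U).2‖ + μ₁ * ‖v‖ ≤ RHist (k + 1))
    {terms : (tsys 4 (R.cubesPerDir (k + 1))).Dom → Finset (Σ _ : Finset (TPt 4 (R.cubesPerDir (k + 1))), Σ F : Finset (tsys 4 (R.cubesPerDir (k + 1))).Dom, ∀ Z ∈ F,
      (Σ _ : (tsys 4 (R.F.L * R.cubesPerDir (k + 1))).Dom, (Σ _ : Finset (TPt 4 (R.F.L * R.cubesPerDir (k + 1))), Finset (tsys 4 (R.F.L * R.cubesPerDir (k + 1))).Dom × Finset (Bnd R))))}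
    {act : ℂ → (tsys 4 (R.cubesPerDir (k + 1))).Dom → ℂ}
    (hact : ∀ σ ∈ ball (0 : ℂ) μ₁, ∀ Z, act σ Z = ∑ i ∈ terms Z, (𝔊 (k + 1) i (domEmb R (k + 1) Z)).termAt o (h₀ + σ • v))
    {A Rkp r₁ μ₀ : ℝ} (X₀ : (tsys 4 (R.cubesPerDir (k + 1))).Dom) {sμ : ℂ} (hA : 0 ≤ A) (hr₁ : 0 ≤ r₁)
    (hrate : r₁ + 2 * (64 * Real.log 162) + 2 ≤ Rkp) (hsmall : A * Real.exp (5 * r₁ + 1) * K₀ 64 8 * 9 * 64 ≤ 1)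
    {δ κ α₆ Rk s t : ℝ}
    (hα₆ : 0 ≤ α₆) (hκk : 64 * Real.log 162 + 1 ≤ δ * κ) (h229k : Real.exp 1 * K₀ 64 8 * 64 * α₆ ≤ 1)
    (hs0 : 0 ≤ s) (hs1 : s ≤ 1) (ht : 0 ≤ t)
    {ε r Rout vW : ℝ} (hε : 0 ≤ ε) (hvW : 0 ≤ vW)
    (hκR : 64 * Real.log 162 ≤ Rk - 64 * (Real.exp (Rk * 5) * s * Real.exp (4 * (R.F.L : ℝ) ^ (4 * R.m') * t)))
    (hrate2 : r + Rout ≤ (Rk - 64 * (Real.exp (Rk * 5) * s * Real.exp (4 * (R.F.L : ℝ) ^ (4 * R.m') * t)) - 64 * Real.log 162) * ((R.F.L : ℝ) / a236 R.F.L))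
    (hκ : 64 * Real.log 162 + 1 ≤ r)
    (h229 : Real.exp 1 * K₀ 64 8 * 64 *
      (ε * Real.exp (64 * (Real.exp (Rk * 5) * s * Real.exp (4 * (R.F.L : ℝ) ^ (4 * R.m') * t)) - 5 * Rk) * ((3 : ℝ) ^ 4 * (R.F.L : ℝ) ^ 4) * K₀ 64 8 *
        Real.exp (5 * Rout)) ≤ 1)
    (hRR : Rkp ≤ Rout - 64 * (vW * Real.exp (Rout * 5)))
    (hadm : ∀ Z : (tsys 4 (R.cubesPerDir (k + 1))).Dom, ∀ l ∈ terms Z, l.1 ⊆ Z.1 ∧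
      l.2.1 ∈ coveringFamilies Finset.univ (fun Y : (tsys 4 (R.cubesPerDir (k + 1))).Dom => Y.1) (Z.1 \ l.1) ∧
      ∀ Z' (h : Z' ∈ l.2.1), l.2.2 Z' h ∈
        ((Finset.univ : Finset (tsys 4 (R.F.L * R.cubesPerDir (k + 1))).Dom).filter (fun Z₀ => tclosureDom R.F.L (R.cubesPerDir (k + 1)) Z₀ = Z')).sigma fun Z₀ =>
          Z₀.1.powerset.sigma fun W =>
            coveringFamilies Finset.univ (fun Y : (tsys 4 (R.F.L * R.cubesPerDir (k + 1))).Dom => Y.1) (Z₀.1 \ W) ×ˢ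
              (bondsOfFineCubes hk W).powerset.filter fun P => W.card ≤ 2 * P.card)
    (hAmp : ∀ Z : (tsys 4 (R.cubesPerDir (k + 1))).Dom, Z.1 ⊆ X₀.1 → ∀ l ∈ terms Z,
      (𝔊 (k + 1) l (domEmb R (k + 1) Z)).lam.real univ * ((𝔊 (k + 1) l (domEmb R (k + 1) Z)).wB * N₀ (k + 1) l (domEmb R (k + 1) Z) * Real.exp (bq (k + 1) l (domEmb R (k + 1) Z))) *
          (Real.pi / (mq (k + 1) l (domEmb R (k + 1) Z) / 2)) ^ (Module.finrank ℝ (α (k + 1) l) / 2 : ℝ) *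
        Real.exp ((𝔊 (k + 1) l (domEmb R (k + 1) Z)).N₁ * (‖h₀‖ + μ₁ * ‖v‖)) ≤
      A * (vW ^ l.1.card * ∏ x ∈ l.2.1.attach, (ε *
        ((∏ Y ∈ (l.2.2 x.1 x.2).2.2.1,
            (α₆ * Real.exp (-(δ * κ * torusTreeLen Y.1)) * Real.exp (-(Rk * (torusTreeLen Y.1 + 5))))) *
          (s ^ 2 * t) ^ (l.2.2 x.1 x.2).2.2.2.card))))
    (h0 : 0 < μ₀) (h01 : μ₀ < μ₁) (hμ : ‖sμ‖ ≤ μ₀) :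
    ‖locE (TTouch (d := 4) (N := R.cubesPerDir (k + 1))) (fun Z : (tsys 4 (R.cubesPerDir (k + 1))).Dom => Z.1) (act sμ) X₀.1 -
        locE (TTouch (d := 4) (N := R.cubesPerDir (k + 1))) (fun Z : (tsys 4 (R.cubesPerDir (k + 1))).Dom => Z.1) (act 0) X₀.1‖ ≤
      Real.exp 1 * 9 * 64 * K₀ 64 8 ^ 2 * A * Real.exp (-(r₁ * torusTreeLen X₀.1)) * (μ₀ / (μ₁ - μ₀)) :=
  muPart_locE_le_of_coresAt_pencil_components_inner_nestedTori (L := R.F.L) (N' := R.cubesPerDir (k + 1))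
    (by have := R.F.hL11; omega) 𝔊 hroom hm hN hq hg hO hH (emb := fun Z => domEmb R (k + 1) Z) (fun _ => rfl) hact X₀ hA hr₁
    hrate hsmall (bondsOfFineCubes hk) hα₆ hκk h229k hs0 hs1 ht (fun W => card_bondsOfFineCubes_le_real hk W) hε hvW hκR hrate2 hκ
    h229 hRR hadm hAmp h0 h01 hμ

end Summit.QuantumFields.BalabanUV.T4Continuum.NE1p.DressedSmallFieldComponentInnerCarriersBonds

end
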